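import Mathlib
import HarnessLib

/-!
# RVFlatGaugeZoneCPath — the abstract path value of ZONE C of the flat `S₇`-gauge law (fam-rv gen 11, file 1)

HONEST FRAMING: systematic search; no irrationality claim unless certified.  Pure finite combinatorics (natural numbers, lists);
no statement minted by this cell is used as a hypothesis here; nothing about `p`-adic valuations, γ, measures or irrationality.

WHERE THIS SITS.  Gen 7–10 proved the flat `S₇`-gauge law of Rhin–Viola type on the region {at most ONE long block
`b₀ − 2b_k ≥ p`, `b₀ < 3p`} (`RVFlatGauge.flatGaugeLawF1_holds`).  The next slice of the record ray (prime window `(15n, 17n]` on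
`b = n·(41;17,16,15,14,13,12,11)`) is ZONE C: EXACTLY TWO long blocks and `b₀ < 3p` (`families/rv/FAMILY.md` §18.4, §21).
There the non-`E` part of the pair floors plus the denominator floors of gen-1's closed scalar `ρ` — the quantity that the flat gauge
charges beyond the class-law level `min(1,⌊d/p⌋) − N_p` — is a PATH VALUE: the six non-`E` pairs form the Hamiltonian path
`2–7–1–6–4–5–3` of `K₇` (0-based slots `1–6–0–5–3–4–2`), whose five interior vertices are `ρ`'s denominator slots, and for a
labelled vector `c` with long slots `i₁` (the smaller value) and `i₂`
  `nonESum(c) + denSum(c) = f·[i₁i₂ is a path edge] + #{path edges i₁k with c₀−c_{i₁}−c_k ≥ p} + #{path edges i₂k with c₀−c_{i₂}−c_k ≥ p}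
                          + #{interior short slots k with c_k ≥ p}`,   `f = ⌊(c₀−c_{i₁}−c_{i₂})/p⌋ ∈ {1,2}`
(file 2, `RVFlatGaugeZoneC.lean`, proves `≤`).  This file defines that value ABSTRACTLY from slot labels (`pathVal`), its maximum
over all `5040` relabellings (`pathMax`, the identity listed first so that `pathVal ≤ pathMax` is `le_max_left`), and records the
CLOSED FORM `zcM(f, n₁₂, m₂, n_big)` of that maximum found by the gen-11 census (`pub-zeta5-fam-rv/gen11/typelaw.py`,
`check_table.py`: `pathMax = zcM` on all `2 × 21 × 6 = 252` REALISABLE label types `(f, n₂, n₁, n_big)` — the patterns of actual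
vectors, where a big short never has a higher level than a non-big short (both labels are monotone in `c_k`); on the 252 unrealisable
label multisets `pathMax` may exceed `zcM` by one (38 cases) — verified OUTSIDE Lean; inside Lean only the kernel instances below).  Labels of a slot: `lab k % 3` = LEVEL (`1`: the pair with `i₁`
is `≥ p`; `2`: both pairs with `i₁`, `i₂` are `≥ p`), `lab k / 3` = BIG (`c_k ≥ p`); long slots carry label `0`.
-/

namespace Summit.KontsevichZagierPeriods.Zeta5Search.RVFlatGauge.ZoneC

/-! ### The abstract path value -/

/-- Abstract weight of the non-`E` pair `x = (j,k)` (0-based slots): `f` on the long–long edge, the level indicator on a long–short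
edge (`≥ 1` against `i₁`, `= 2` against `i₂`), `0` on a short–short edge. -/
def edgeW (i₁ i₂ f : ℕ) (lab : ℕ → ℕ) (x : ℕ × ℕ) : ℕ :=
  if (x.1 = i₁ ∧ x.2 = i₂) ∨ (x.1 = i₂ ∧ x.2 = i₁) then f
  else if x.1 = i₁ then (if 1 ≤ lab x.2 % 3 then 1 else 0)
  else if x.2 = i₁ then (if 1 ≤ lab x.1 % 3 then 1 else 0)
  else if x.1 = i₂ then (if lab x.2 % 3 = 2 then 1 else 0)
  else if x.2 = i₂ then (if lab x.1 % 3 = 2 then 1 else 0)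
  else 0

/-- Big indicator of a slot (`lab k / 3 ≥ 1`). -/
def bigAt (lab : ℕ → ℕ) (k : ℕ) : ℕ := if 1 ≤ lab k / 3 then 1 else 0

/-- **The abstract path value**: the six non-`E` edge weights (pairs `(0,5),(0,6),(1,6),(2,4),(3,4),(3,5)` = `RVFlatGauge.nonE`)
plus the big indicators of the five interior = denominator slots `{0,3,4,5,6}` (= `RVFlatGauge.Cap.denSlots`). -/
def pathVal (i₁ i₂ f : ℕ) (lab : ℕ → ℕ) : ℕ :=
  edgeW i₁ i₂ f lab (0, 5) + edgeW i₁ i₂ f lab (0, 6) + edgeW i₁ i₂ f lab (1, 6) + edgeW i₁ i₂ f lab (2, 4) +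
    edgeW i₁ i₂ f lab (3, 4) + edgeW i₁ i₂ f lab (3, 5) +
    (bigAt lab 0 + bigAt lab 3 + bigAt lab 4 + bigAt lab 5 + bigAt lab 6)

/-! ### All relabellings (structural enumeration of `S₇`) and the path maximum -/

/-- Insert `a` at every position of a list. -/
def insAll (a : ℕ) : List ℕ → List (List ℕ)
  | [] => [[a]]
  | b :: l => (a :: b :: l) :: (insAll a l).map (b :: ·)

/-- All permutations of a list (structural recursion; `List.permutations` avoided on purpose: kernel-evaluable). -/
def permsOf : List ℕ → List (List ℕ)
  | [] => [[]]
  | a :: l => (permsOf l).flatMap (insAll a)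

/-- The `5040` relabellings of the seven lower slots, each as the list `π` with `π[k]` = new slot of old slot `k`. -/
def perms7 : List (List ℕ) := permsOf [0, 1, 2, 3, 4, 5, 6]

/-- The path value after the relabelling whose INVERSE is `τ` (`τ[m]` = old slot sitting at new slot `m`): the long slots move to
the positions of `i₁, i₂` in `τ`, and new slot `m` carries the label of old slot `τ[m]`. -/
def pathValPerm (f : ℕ) (lab : ℕ → ℕ) (i₁ i₂ : ℕ) (τ : List ℕ) : ℕ :=
  pathVal (τ.idxOf i₁) (τ.idxOf i₂) f (fun m => lab (τ.getD m 0))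

/-- **The zone-C path maximum**: the maximum of the path value over all `5040` relabellings (the identity is listed first, so that
`pathVal ≤ pathMax` is immediate; it is also among `perms7`).  By construction invariant under relabelling of the input. -/
def pathMax (f : ℕ) (lab : ℕ → ℕ) (i₁ i₂ : ℕ) : ℕ :=
  max (pathVal i₁ i₂ f lab) ((perms7.map (pathValPerm f lab i₁ i₂)).foldl max 0)

/-- The labelled value is bounded by the maximum over relabellings. -/
theorem pathVal_le_pathMax (f : ℕ) (lab : ℕ → ℕ) (i₁ i₂ : ℕ) : pathVal i₁ i₂ f lab ≤ pathMax f lab i₁ i₂ :=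
  le_max_left _ _

set_option maxRecDepth 200000 in
/-- `perms7` lists `7! = 5040` relabellings, the identity among them (kernel check). -/
theorem perms7_length : perms7.length = 5040 ∧ [0, 1, 2, 3, 4, 5, 6] ∈ perms7 := by
  decide +kernel

/-! ### The closed form of the maximum (census; verified outside Lean) -/

/-- Base edge value of a label type: `f + [n₁₂ ≥ 1] + [m₂ ≥ 1] + [f = 1 ∧ m₂ ≥ 2]` (`n₁₂` = shorts of level `≥ 1`,
`m₂ = min(n₂, n₁₂ − 1)` usable level-2 shorts). -/
def zcBase (f n12 m2 : ℕ) : ℕ :=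
  f + (if 1 ≤ n12 then 1 else 0) + (if 1 ≤ m2 then 1 else 0) + (if f = 1 ∧ 2 ≤ m2 then 1 else 0)

/-- First stall threshold in `n_big` (a non-big level short occupying an interior slot, or a big lost to an end of the path). -/
def zcK1 (f n12 m2 : ℕ) : ℕ :=
  if m2 = 0 then (if n12 = 1 then 4 else 5)
  else if m2 = 1 then (if n12 = 2 then 3 else 4)
  else if m2 = 2 ∧ f = 1 then (if n12 = 3 then 2 else 3)
  else 4

/-- Second stall threshold (`6` = none). -/
def zcK2 (f m2 : ℕ) : ℕ :=
  if m2 = 0 then 6 else if m2 = 1 then (if f = 1 then 6 else 5) else 5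

/-- **The closed form `zcM(f, n₁₂, m₂, n_big) = base + n_big − [n_big ≥ κ₁] − [n_big ≥ κ₂]`** of the zone-C path maximum
(gen-11 census: equal to `pathMax` on every REALISABLE label type — the `2 × 21 × 6 = 252` count types `(f, n₂, n₁, n_big)` of
sorted patterns — verified by `pub-zeta5-fam-rv/gen11/check_table.py` (`out/check_table.txt`), NOT inside Lean; see the kernel
instances below for agreement on examples; NOT valid for unsorted label patterns).
Values (rows `(n₂,n₁)`, columns `n_big = 0…5`): `f = 1`: `(0,0) ↦ 1,2,3,4,5,5`; `(0,1),(1,0) ↦ 2,3,4,5,5,6`; `(1,1),(2,0) ↦ 3,4,5,5,6,7`;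
`(2,1),(3,0) ↦ 4,5,5,6,7,7`; `(3,1) ↦ 4,5,6,7,7,7`; `f = 2`: `(0,0) ↦ 2,3,4,5,6,6`; `(1,1),(2,0) ↦ 4,5,6,6,7,7`; never above `7`. -/
def zcM (f n12 m2 nb : ℕ) : ℕ :=
  zcBase f n12 m2 + nb - ((if zcK1 f n12 m2 ≤ nb then 1 else 0) + (if zcK2 f m2 ≤ nb then 1 else 0))

/-! ### The labels of a concrete zone-C vector (pure integer arithmetic; used by file 2) -/

/-- Level test: the pair form of (long) slot `i` with slot `k` is `≥ p` (0-based slots). -/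
def lam (c : ℕ → ℤ) (p i k : ℕ) : Bool := decide ((p : ℤ) ≤ c 0 - c (i + 1) - c (k + 1))

/-- Big test: `c_k ≥ p` (0-based slot `k`). -/
def bigB (c : ℕ → ℤ) (p k : ℕ) : Bool := decide ((p : ℤ) ≤ c (k + 1))

/-- The label of slot `k` of a zone-C vector with long slots `i₁` (smaller value), `i₂`: `0` on the long slots, else
`3·[big] + level`, `level = 2` if both long–short forms are `≥ p`, `1` if only the one with `i₁`, `0` otherwise. -/
def labC (c : ℕ → ℤ) (p i₁ i₂ k : ℕ) : ℕ :=
  if k = i₁ ∨ k = i₂ then 0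
  else (if bigB c p k then 3 else 0) + (if lam c p i₁ k then (if lam c p i₂ k then 2 else 1) else 0)

/-- `f = ⌊(c₀ − c_{i₁} − c_{i₂})/p⌋ ∈ {1, 2}` on zone C, as the digit `1 + [2p ≤ form]`. -/
def fLL (c : ℕ → ℤ) (p i₁ i₂ : ℕ) : ℕ := if 2 * (p : ℤ) ≤ c 0 - c (i₁ + 1) - c (i₂ + 1) then 2 else 1

/-! ### Floor values of pair forms below `3p` (pure integer arithmetic; used by file 2) -/

/-- A pair form of two slots is at most `c₀ < 3p`, so its floor is at most `fLL`-style digit: `≤ 2`, and `≤ 1` below `2p`. -/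
theorem pf_le_fLL (c : ℕ → ℤ) {p : ℕ} (hp0 : (0 : ℤ) < p) (hc3 : c 0 < 3 * (p : ℤ)) {a b : ℕ}
    (ha : 0 ≤ c (a + 1)) (hb : 0 ≤ c (b + 1)) :
    (c 0 - c (a + 1) - c (b + 1)) / (p : ℤ) ≤ (fLL c p a b : ℤ) := by
  unfold fLL
  by_cases h2 : 2 * (p : ℤ) ≤ c 0 - c (a + 1) - c (b + 1)
  · rw [if_pos h2]
    have := (Int.ediv_lt_iff_lt_mul hp0).2 (show c 0 - c (a + 1) - c (b + 1) < 3 * (p : ℤ) by linarith)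
    push_cast; omega
  · rw [if_neg h2]
    have := (Int.ediv_lt_iff_lt_mul hp0).2 (show c 0 - c (a + 1) - c (b + 1) < 2 * (p : ℤ) by linarith)
    push_cast; omega

/-- A long–short pair form lies in `[0, 2p)`: its floor is the level indicator `[p ≤ form]`. -/
theorem pf_long_short (c : ℕ → ℤ) {p : ℕ} (hp0 : (0 : ℤ) < p) (hc3 : c 0 < 3 * (p : ℤ)) {i k : ℕ}
    (hi : 0 ≤ c (i + 1)) (hk2 : 2 * c (k + 1) ≤ c 0) (hi2 : 2 * c (i + 1) ≤ c 0) (hk : c 0 - 2 * c (k + 1) < (p : ℤ)) :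
    (c 0 - c (i + 1) - c (k + 1)) / (p : ℤ) = if (p : ℤ) ≤ c 0 - c (i + 1) - c (k + 1) then 1 else 0 := by
  have hlt : c 0 - c (i + 1) - c (k + 1) < 2 * (p : ℤ) := by linarith
  have h0 : 0 ≤ c 0 - c (i + 1) - c (k + 1) := by linarith
  have hq1 := (Int.ediv_lt_iff_lt_mul hp0).2 hlt
  split_ifs with h
  · have := (Int.le_ediv_iff_mul_le hp0).2 (show (1 : ℤ) * p ≤ c 0 - c (i + 1) - c (k + 1) by linarith)
    omega
  · exact Int.ediv_eq_zero_of_lt h0 (by linarith)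

/-- A short–short pair form lies in `[0, p)`: its floor vanishes. -/
theorem pf_short_short (c : ℕ → ℤ) {p : ℕ} {a b : ℕ} (ha2 : 2 * c (a + 1) ≤ c 0) (hb2 : 2 * c (b + 1) ≤ c 0)
    (ha : c 0 - 2 * c (a + 1) < (p : ℤ)) (hb : c 0 - 2 * c (b + 1) < (p : ℤ)) :
    (c 0 - c (a + 1) - c (b + 1)) / (p : ℤ) = 0 :=
  Int.ediv_eq_zero_of_lt (by linarith) (by linarith)

/-- The level of a short slot read off its label: `labC k % 3 = [lam i₁ k] + [lam i₁ k ∧ lam i₂ k]`. -/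
theorem labC_mod_three (c : ℕ → ℤ) (p : ℕ) {i₁ i₂ k : ℕ} (hk : ¬ (k = i₁ ∨ k = i₂)) :
    labC c p i₁ i₂ k % 3 = (if lam c p i₁ k then (if lam c p i₂ k then 2 else 1) else 0) := by
  unfold labC; rw [if_neg hk]; split_ifs <;> norm_num

/-- The big bit of a short slot read off its label: `labC k / 3 = [c_k ≥ p]`. -/
theorem labC_div_three (c : ℕ → ℤ) (p : ℕ) {i₁ i₂ k : ℕ} (hk : ¬ (k = i₁ ∨ k = i₂)) :
    labC c p i₁ i₂ k / 3 = (if bigB c p k then 1 else 0) := by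
  unfold labC; rw [if_neg hk]; split_ifs <;> norm_num

/-- On an oriented zone-C vector (`c_{i₁} ≤ c_{i₂}`), a level with `i₂` implies the level with `i₁`. -/
theorem lam_of_lam (c : ℕ → ℤ) (p : ℕ) {i₁ i₂ k : ℕ} (hle : c (i₁ + 1) ≤ c (i₂ + 1))
    (h : lam c p i₂ k = true) : lam c p i₁ k = true := by
  simp only [lam, decide_eq_true_eq] at h ⊢; linarith

/-! ### Kernel instances -/

/-- Labels from a 7-list (slot `k ↦ l[k]`, `0` beyond). -/
def labOf (l : List ℕ) (k : ℕ) : ℕ := l.getD k 0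

set_option maxRecDepth 200000 in
/-- The census example `b = (10;5,5,5,5,5,0,0)`, `p = 5` (long slots `5, 6`, `f = ⌊10/5⌋ = 2`, the five shorts big (`5 ≥ 5`) and of
level `2` (`10 − 0 − 5 ≥ 5` twice): labels `3·1 + 2 = 5`): `pathMax = 7 = zcM 2 5 4 5` (and `7` is the absolute ceiling). -/
example : pathMax 2 (labOf [5, 5, 5, 5, 5, 0, 0]) 5 6 = 7 ∧ zcM 2 5 (min 5 4) 5 = 7 := by
  decide +kernel

set_option maxRecDepth 200000 in
/-- The census example `b = (12;5,4,4,4,4,0,0)`, `p = 5` (long slots `5, 6`, `f = 2`; the short `5` is big and of level `2`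
(`12 − 0 − 5 = 7 ≥ 5`): label `5`; the shorts `4` are non-big of level `2`: label `2`): `pathMax = 2 + 1 + 1 + 1 = 5 = zcM 2 5 4 1`. -/
example : pathMax 2 (labOf [5, 2, 2, 2, 2, 0, 0]) 5 6 = 5 ∧ zcM 2 5 (min 5 4) 1 = 5 := by
  decide +kernel

end Summit.KontsevichZagierPeriods.Zeta5Search.RVFlatGauge.ZoneC
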